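import Summits.BirchSwinnertonDyer.BirchSwinnertonDyer.Theorems.CumulativeHeegnerLeopoldtCumulativeHeegnerInclusionAtThreeLayerTower
import Summits.BirchSwinnertonDyer.BirchSwinnertonDyer.Theorems.CumulativeHeegnerLeopoldtCumulativeHeegnerInclusionAtThreeLayerFitting
import HarnessLib

/-!
# Crux K1 `CumulativeHeegnerInclusionAtThree` (stmt-BirchSwinnertonDyer-24198) / crux A (stmt-26896):
# the MAZUR–TATE DOOR — equivariant layer Fitting memberships over `Λ ⧸ (ω_m) = ℤ₃[Γ/Γ_m]` give A, and
# (with the print input P, or integrally) K1, BY NAME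

Width seat bsd-line-chl-k1-p1-w7 g0 (`--supports stmt-BirchSwinnertonDyer-24198`), lane [P-ctl] (c4), capstone. THEOREMS
ONLY (no definition, no named fact, no `sorry`). Imports the route file only through the landed layer-tower door
(`…LayerTower`, p637184). Nothing here proves K1, A or any summit statement: the hypothesis (MT) below is DISPLAYED,
not constructed — its construction is the research content [R-layer-KS] + [R-layer-rec] of the K1 lead's census
(`Cruxes/CumulativeHeegnerInclusionAtThree/A26896-LINE-CENSUS-g6.md` §2, `LAYER-TOWER-DOOR-w2g5.md` §2). BSD is not
proved by any of this.

## The door (MT)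

At every frame of crux A (= the binders of K1: Leopoldt cell at wild additive `3`, `K` Heegner with `3` split,
anticyclotomic `κ`, `γ`, `𝔭 ≠ 𝔭′`, branch, BDP function `L`), for `X = X_{∅,0}(𝔭′) = XAc (W.baseChange K) 3 κ 𝔭′ ∅ γ`
and `ω_m = (1+T)^{3^m} − 1`:

  (MT)  `∃ μ ∃ (θ_m)_m ∀ m:  θ̄_m ∈ Fitt₀^{Λ/(ω_m)}(X ⧸ ω_m X)  ∧  3^μ · L ∈ (θ_m) + (3^m) + (ω_m)` in `R₀⟦T⟧`,

i.e. at every layer `m` an element of the FITTING IDEAL OVER THE LAYER RING `Λ ⧸ (ω_m) = ℤ₃[Gal(K_m/K)]` of the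
`Λ ⧸ (ω_m)`-module `X ⧸ ω_m X` — which, under the exact layer control now in the tree (`…LayerControl`,
`…LayerControlCurve`, `…LayerControlCell`, `…LayerDual`, `…LayerControlDual`), IS the Pontryagin dual of the
layer Selmer group `Sel_{𝔭′}^Σ(K_m, E[3^∞])` for `Σ ⊇ {bad v ∤ 3}` — dividing `3^μ · L` modulo `(3^m, ω_m)` up to
the layer congruence. This is literally the shape of a Mazur–Tate / Kurihara / Kim–Kurihara theorem
("`θ_m ∈ Fitt_{ℤ_p[G_m]}(Sel(K_m)^∨)`"), stated for the anticyclotomic tower and Castella's conditions.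

* **`temperedHeegnerInclusionAtThree_of_mazurTateTower`** — (MT) ⟹ A (`TemperedHeegnerInclusionAtThree`), by
  `…LayerFitting.forall_pow_mul_mem_map_fittingIdeal_sup_layer_of_quotientFitting` (Stacks 07ZA (3): the
  residue class lifts into `Fitt₀^Λ(X) + (ω_m)`) and `…LayerTower.temperedHeegnerInclusionAtThree_of_fittingLayerTower`
  (`Fitt ⊆ Ch` + Krull): the exponent of A is the `μ` of (MT), no loss;
* **`cumulativeHeegnerInclusionAtThree_of_print_of_mazurTateTower`** — P ∧ (MT) ⟹ K1 (P = the print input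
  `ResidualSelmerPrintedInputAtThree`, CGLS22 Prop. 14, removing `3^μ` by saturation as in the line's glue);
* **`cumulativeHeegnerInclusionAtThree_of_integralMazurTateTower`** — INTEGRAL (MT) (`μ = 0`) ⟹ K1, print-free.

References: [MazurTate1987] §1; [KimKurihara2021] §1; [BertoliniDarmon1990] §2; [StacksProject] Tag 07ZA.
-/

noncomputable section

-- every declaration of this file lives in the doubled summit namespace `Summit.BirchSwinnertonDyer.BirchSwinnertonDyer…`
set_option linter.dupNamespace false

namespace Summit.BirchSwinnertonDyer.BirchSwinnertonDyer.Theorems.CumulativeHeegnerInclusionAtThreeLayerFittingDoor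

open NumberField IsDedekindDomain
open Literature.NumberTheory.EllipticCurves Literature.RingTheory.FittingIdeal
open Summit.BirchSwinnertonDyer.Rank1Residual.X11b Summit.BirchSwinnertonDyer.Rank1Residual.X11b.AcSelmer
open Summit.BirchSwinnertonDyer.BirchSwinnertonDyer.Theorems.CumulativeHeegnerInclusionAtThreeLayerTower
open Summit.BirchSwinnertonDyer.BirchSwinnertonDyer.Theorems.CumulativeHeegnerInclusionAtThreeLayerFitting

/-- **The Mazur–Tate door for crux A: (MT) ⟹ `TemperedHeegnerInclusionAtThree`.** If at every frame of A some
fixed `3^μ` and layer elements `θ_m ∈ Λ = ℤ₃⟦T⟧` satisfy, for EVERY layer `m`, (i) the residue of `θ_m` lies in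
the Fitting ideal over the layer ring `Λ ⧸ (ω_m)` of `X_{∅,0}(𝔭′) ⧸ ω_m X_{∅,0}(𝔭′)` and (ii) the layer
congruence `3^μ · L ∈ (θ_m) + (3^m) + (ω_m)` in `R₀⟦T⟧`, then A holds — with the SAME `μ`. Composition of
`forall_pow_mul_mem_map_fittingIdeal_sup_layer_of_quotientFitting` (equivariant currency ⟹ (LT), Stacks 07ZA (3))
and `temperedHeegnerInclusionAtThree_of_fittingLayerTower` ((LT) ⟹ A). Nothing about the existence of the `θ_m`
is asserted. [cite: MazurTate1987, §1] [cite: KimKurihara2021, §1] [cite: StacksProject, Tag 07ZA] -/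
theorem temperedHeegnerInclusionAtThree_of_mazurTateTower
    (hMT : ∀ (W : WeierstrassCurve ℚ) [W.IsElliptic] [W.IsGloballyMinimal] (N : ℕ) [NeZero N] (K : Type) [Field K] [NumberField K] (Dt : Literature.NumberTheory.EllipticCurves.ModularForms.ModularParametrizationData W N), Summit.BirchSwinnertonDyer.Rank1Residual.Additive.ClassO6 W 3 → Literature.NumberTheory.EllipticCurves.Rank1Residual.Red W 3 → (∃ Φ : AddSubgroup (WeierstrassCurve.geomTorsion W ((3 : ℕ) : ℤ)), Literature.NumberTheory.EllipticCurves.Rank1Residual.IsRationalLine W 3 Φ ∧ ∀ (v : IsDedekindDomain.HeightOneSpectrum (NumberField.RingOfIntegers ℚ)), ((3 : ℕ) : NumberField.RingOfIntegers ℚ) ∈ v.asIdeal → ∀ 𝔓 ∈ v.primesAbove, ¬ (∀ g ∈ 𝔓.decompositionSubgroup (Field.absoluteGaloisGroup ℚ), ∀ P ∈ Φ, g • P = P) ∧ ¬ (∀ g ∈ 𝔓.decompositionSubgroup (Field.absoluteGaloisGroup ℚ), ∀ P : WeierstrassCurve.geomTorsion W ((3 : ℕ) : ℤ), g • P - P ∈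 Φ)) → W.analyticRank = 1 → W.conductorNorm ℤ = N → Literature.NumberTheory.EllipticCurves.IsImaginaryQuadratic K → Literature.NumberTheory.EllipticCurves.SatisfiesHeegnerHypothesis N K → ∀ (κ : Literature.NumberTheory.EllipticCurves.ZpExtension K 3), κ.IsAnticyclotomic → ∀ (γ : Field.absoluteGaloisGroup K) [Fact (κ.IsTopGenerator γ)] (𝔭 : IsDedekindDomain.HeightOneSpectrum (NumberField.RingOfIntegers K)), ((3 : ℕ) : NumberField.RingOfIntegers K) ∈ 𝔭.asIdeal → 𝔭.asIdeal.ramificationIdx (NumberField.RingOfIntegers ℚ) = 1 → 𝔭.asIdeal.inertiaDeg (NumberField.RingOfIntegers ℚ) = 1 → ∀ (𝔭' : IsDedekindDomain.HeightOneSpectrum (NumberField.RingOfIntegers K)), ((3 : ℕ) : NumberField.RingOfIntegers K) ∈ 𝔭'.asIdeal → 𝔭' ≠ 𝔭 → ∀ (ι' : PadicAlgCl 3 ≃+* ℂ), Summit.BirchSwinnertonDyer.BirchSwinnertonDyer.Theorems.SchneiderFree.BranchInducesPrime 3 ι' 𝔭 → ∀ (ΩK : ℂ) (Ωp : ℂ_[3])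 (L : Literature.NumberTheory.EllipticCurves.UnrSeries 3), ΩK ≠ 0 → Ωp ≠ 0 → Literature.NumberTheory.EllipticCurves.IsBDPLFunction ι' 𝔭 κ γ Dt.f ΩK Ωp L → ∃ μ : ℕ, ∃ θ : ℕ → Literature.NumberTheory.EllipticCurves.IwasawaAlgebra 3, ∀ m : ℕ, (Ideal.Quotient.mk (Ideal.span {((1 + PowerSeries.X) ^ (3 ^ m) - 1 : Literature.NumberTheory.EllipticCurves.IwasawaAlgebra 3)}) (θ m) ∈ Literature.RingTheory.FittingIdeal.Module.fittingIdeal (Literature.NumberTheory.EllipticCurves.IwasawaAlgebra 3 ⧸ Ideal.span {((1 + PowerSeries.X) ^ (3 ^ m) - 1 : Literature.NumberTheory.EllipticCurves.IwasawaAlgebra 3)}) (Summit.BirchSwinnertonDyer.Rank1Residual.X11b.AcSelmer.XAc (W.baseChange K) 3 κ 𝔭' ∅ γ ⧸ (Ideal.span {((1 + PowerSeries.X) ^ (3 ^ m) - 1 : Literature.NumberTheory.EllipticCurves.IwasawaAlgebra 3)} • (⊤ : Submodule (Literature.NumberTheory.EllipticCurves.IwasawaAlgebra 3) (Summit.BirchSwinnertonDyer.Rank1Residual.X11b.AcSelmer.XAc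 (W.baseChange K) 3 κ 𝔭' ∅ γ)))) 0) ∧ (3 : Literature.NumberTheory.EllipticCurves.UnrSeries 3) ^ μ * L ∈ Ideal.span {PowerSeries.map (Summit.BirchSwinnertonDyer.Rank1Residual.X11b.Halves.toUnr 3) (θ m)} ⊔ Ideal.span {(3 : Literature.NumberTheory.EllipticCurves.UnrSeries 3) ^ m} ⊔ Ideal.span {((1 + PowerSeries.X) ^ (3 ^ m) - 1 : Literature.NumberTheory.EllipticCurves.UnrSeries 3)}) :
    Summit.BirchSwinnertonDyer.BirchSwinnertonDyer.Theses.CumulativeHeegnerLeopoldt.TemperedHeegnerInclusionAtThree := by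
  refine temperedHeegnerInclusionAtThree_of_fittingLayerTower ?_
  intro W _ _ N _ K _ _ Dt hO6 hRed hcell hr hN hK hHg κ hκ γ _ 𝔭 h𝔭 he hf 𝔭' h𝔭' hne ι' hι ΩK Ωp L hΩK hΩp hBDP
  haveI : (W.baseChange K).IsElliptic := inferInstanceAs (W.map (algebraMap ℚ K)).IsElliptic
  haveI : Module.Finite (IwasawaAlgebra 3) (XAc (W.baseChange K) 3 κ 𝔭' ∅ γ) := XAc.module_finite_empty κ 𝔭' γ
  obtain ⟨μ, θ, hθ⟩ := hMT W N K Dt hO6 hRed hcell hr hN hK hHg κ hκ γ 𝔭 h𝔭 he hf 𝔭' h𝔭' hne ι' hι ΩK Ωp L hΩK hΩp hBDP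
  refine ⟨μ, fun m ↦ ?_⟩
  rw [three_eq_natCast]
  exact forall_pow_mul_mem_map_fittingIdeal_sup_layer_of_quotientFitting (p := 3) μ θ (fun m ↦ (hθ m).1)
    (fun m ↦ by rw [← three_eq_natCast]; exact (hθ m).2) m

/-- **K1 ⟸ P ∧ (MT)** by name: the print input P (`ResidualSelmerPrintedInputAtThree` = CGLS22 Prop. 14) and the
Mazur–Tate tower give the route crux `CumulativeHeegnerInclusionAtThree` — (MT) ⟹ (LT) (equivariant currency,
Stacks 07ZA (3)) and `cumulativeHeegnerInclusionAtThree_of_print_of_fittingLayerTower` (P removes `3^μ` by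
saturation, UTD Greenberg criterion). [cite: CastellaGrossiLeeSkinner2022, §1.2 Prop. 14 (arXiv:2008.02571)]
[cite: MazurTate1987, §1] [cite: StacksProject, Tag 07ZA] -/
theorem cumulativeHeegnerInclusionAtThree_of_print_of_mazurTateTower
    (hP : Summit.BirchSwinnertonDyer.BirchSwinnertonDyer.Theses.CumulativeHeegnerLeopoldt.ResidualSelmerPrintedInputAtThree)
    (hMT : ∀ (W : WeierstrassCurve ℚ) [W.IsElliptic] [W.IsGloballyMinimal] (N : ℕ) [NeZero N] (K : Type) [Field K] [NumberField K] (Dt : Literature.NumberTheory.EllipticCurves.ModularForms.ModularParametrizationData W N), Summit.BirchSwinnertonDyer.Rank1Residual.Additive.ClassO6 W 3 → Literature.NumberTheory.EllipticCurves.Rank1Residual.Red W 3 → (∃ Φ : AddSubgroup (WeierstrassCurve.geomTorsion W ((3 : ℕ) : ℤ)), Literature.NumberTheory.EllipticCurves.Rank1Residual.IsRationalLine W 3 Φ ∧ ∀ (v : IsDedekindDomain.HeightOneSpectrum (NumberField.RingOfIntegers ℚ)), ((3 : ℕ) : NumberField.RingOfIntegers ℚ) ∈ v.asIdeal → ∀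 𝔓 ∈ v.primesAbove, ¬ (∀ g ∈ 𝔓.decompositionSubgroup (Field.absoluteGaloisGroup ℚ), ∀ P ∈ Φ, g • P = P) ∧ ¬ (∀ g ∈ 𝔓.decompositionSubgroup (Field.absoluteGaloisGroup ℚ), ∀ P : WeierstrassCurve.geomTorsion W ((3 : ℕ) : ℤ), g • P - P ∈ Φ)) → W.analyticRank = 1 → W.conductorNorm ℤ = N → Literature.NumberTheory.EllipticCurves.IsImaginaryQuadratic K → Literature.NumberTheory.EllipticCurves.SatisfiesHeegnerHypothesis N K → ∀ (κ : Literature.NumberTheory.EllipticCurves.ZpExtension K 3), κ.IsAnticyclotomic → ∀ (γ : Field.absoluteGaloisGroup K) [Fact (κ.IsTopGenerator γ)] (𝔭 : IsDedekindDomain.HeightOneSpectrum (NumberField.RingOfIntegers K)), ((3 : ℕ) : NumberField.RingOfIntegers K) ∈ 𝔭.asIdeal → 𝔭.asIdeal.ramificationIdx (NumberField.RingOfIntegers ℚ) = 1 → 𝔭.asIdeal.inertiaDeg (NumberField.RingOfIntegers ℚ) = 1 → ∀ (𝔭' : IsDedekindDomain.HeightOneSpectrum (NumberField.RingOfIntegers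 K)), ((3 : ℕ) : NumberField.RingOfIntegers K) ∈ 𝔭'.asIdeal → 𝔭' ≠ 𝔭 → ∀ (ι' : PadicAlgCl 3 ≃+* ℂ), Summit.BirchSwinnertonDyer.BirchSwinnertonDyer.Theorems.SchneiderFree.BranchInducesPrime 3 ι' 𝔭 → ∀ (ΩK : ℂ) (Ωp : ℂ_[3]) (L : Literature.NumberTheory.EllipticCurves.UnrSeries 3), ΩK ≠ 0 → Ωp ≠ 0 → Literature.NumberTheory.EllipticCurves.IsBDPLFunction ι' 𝔭 κ γ Dt.f ΩK Ωp L → ∃ μ : ℕ, ∃ θ : ℕ → Literature.NumberTheory.EllipticCurves.IwasawaAlgebra 3, ∀ m : ℕ, (Ideal.Quotient.mk (Ideal.span {((1 + PowerSeries.X) ^ (3 ^ m) - 1 : Literature.NumberTheory.EllipticCurves.IwasawaAlgebra 3)}) (θ m) ∈ Literature.RingTheory.FittingIdeal.Module.fittingIdeal (Literature.NumberTheory.EllipticCurves.IwasawaAlgebra 3 ⧸ Ideal.span {((1 + PowerSeries.X) ^ (3 ^ m) - 1 : Literature.NumberTheory.EllipticCurves.IwasawaAlgebra 3)}) (Summit.BirchSwinnertonDyer.Rank1Residual.X11b.AcSelmer.XAc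 (W.baseChange K) 3 κ 𝔭' ∅ γ ⧸ (Ideal.span {((1 + PowerSeries.X) ^ (3 ^ m) - 1 : Literature.NumberTheory.EllipticCurves.IwasawaAlgebra 3)} • (⊤ : Submodule (Literature.NumberTheory.EllipticCurves.IwasawaAlgebra 3) (Summit.BirchSwinnertonDyer.Rank1Residual.X11b.AcSelmer.XAc (W.baseChange K) 3 κ 𝔭' ∅ γ)))) 0) ∧ (3 : Literature.NumberTheory.EllipticCurves.UnrSeries 3) ^ μ * L ∈ Ideal.span {PowerSeries.map (Summit.BirchSwinnertonDyer.Rank1Residual.X11b.Halves.toUnr 3) (θ m)} ⊔ Ideal.span {(3 : Literature.NumberTheory.EllipticCurves.UnrSeries 3) ^ m} ⊔ Ideal.span {((1 + PowerSeries.X) ^ (3 ^ m) - 1 : Literature.NumberTheory.EllipticCurves.UnrSeries 3)}) :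
    Summit.BirchSwinnertonDyer.BirchSwinnertonDyer.Theses.CumulativeHeegnerLeopoldt.CumulativeHeegnerInclusionAtThree := by
  refine cumulativeHeegnerInclusionAtThree_of_print_of_fittingLayerTower hP ?_
  intro W _ _ N _ K _ _ Dt hO6 hRed hcell hr hN hK hHg κ hκ γ _ 𝔭 h𝔭 he hf 𝔭' h𝔭' hne ι' hι ΩK Ωp L hΩK hΩp hBDP
  haveI : (W.baseChange K).IsElliptic := inferInstanceAs (W.map (algebraMap ℚ K)).IsElliptic
  haveI : Module.Finite (IwasawaAlgebra 3) (XAc (W.baseChange K) 3 κ 𝔭' ∅ γ) := XAc.module_finite_empty κ 𝔭' γ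
  obtain ⟨μ, θ, hθ⟩ := hMT W N K Dt hO6 hRed hcell hr hN hK hHg κ hκ γ 𝔭 h𝔭 he hf 𝔭' h𝔭' hne ι' hι ΩK Ωp L hΩK hΩp hBDP
  refine ⟨μ, fun m ↦ ?_⟩
  rw [three_eq_natCast]
  exact forall_pow_mul_mem_map_fittingIdeal_sup_layer_of_quotientFitting (p := 3) μ θ (fun m ↦ (hθ m).1)
    (fun m ↦ by rw [← three_eq_natCast]; exact (hθ m).2) m

/-- **K1 ⟸ the INTEGRAL Mazur–Tate tower, print-free.** If at every frame there are layer elements `θ_m ∈ Λ`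
with residues in `Fitt₀^{Λ/(ω_m)}(X_{∅,0}(𝔭′) ⧸ ω_m)` and `L ∈ (θ_m) + (3^m) + (ω_m)` for EVERY `m` (no `3^μ`),
then `CumulativeHeegnerInclusionAtThree` holds outright: (MT) with `μ = 0` ⟹ `L ∈ Fitt₀(X)·R₀⟦T⟧ + (3^m) + (ω_m)`
for all `m` ⟹ (`Fitt ⊆ Ch`, `map_fittingIdeal_le_map_charIdeal`) the integral `Ch`-layer tower ⟹ K1
(`cumulativeHeegnerInclusionAtThree_of_integralCharLayerTower`). No print input, no saturation.
[cite: MazurTate1987, §1] [cite: SkinnerUrban2014, §3.1.6] [cite: StacksProject, Tag 07ZA] -/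
theorem cumulativeHeegnerInclusionAtThree_of_integralMazurTateTower
    (hMT : ∀ (W : WeierstrassCurve ℚ) [W.IsElliptic] [W.IsGloballyMinimal] (N : ℕ) [NeZero N] (K : Type) [Field K] [NumberField K] (Dt : Literature.NumberTheory.EllipticCurves.ModularForms.ModularParametrizationData W N), Summit.BirchSwinnertonDyer.Rank1Residual.Additive.ClassO6 W 3 → Literature.NumberTheory.EllipticCurves.Rank1Residual.Red W 3 → (∃ Φ : AddSubgroup (WeierstrassCurve.geomTorsion W ((3 : ℕ) : ℤ)), Literature.NumberTheory.EllipticCurves.Rank1Residual.IsRationalLine W 3 Φ ∧ ∀ (v : IsDedekindDomain.HeightOneSpectrum (NumberField.RingOfIntegers ℚ)), ((3 : ℕ) : NumberField.RingOfIntegers ℚ) ∈ v.asIdeal → ∀ 𝔓 ∈ v.primesAbove, ¬ (∀ g ∈ 𝔓.decompositionSubgroup (Field.absoluteGaloisGroup ℚ), ∀ P ∈ Φ, g • P = P) ∧ ¬ (∀ g ∈ 𝔓.decompositionSubgroup (Field.absoluteGaloisGroup ℚ), ∀ P : WeierstrassCurve.geomTorsion W ((3 : ℕ) : ℤ), g •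 P - P ∈ Φ)) → W.analyticRank = 1 → W.conductorNorm ℤ = N → Literature.NumberTheory.EllipticCurves.IsImaginaryQuadratic K → Literature.NumberTheory.EllipticCurves.SatisfiesHeegnerHypothesis N K → ∀ (κ : Literature.NumberTheory.EllipticCurves.ZpExtension K 3), κ.IsAnticyclotomic → ∀ (γ : Field.absoluteGaloisGroup K) [Fact (κ.IsTopGenerator γ)] (𝔭 : IsDedekindDomain.HeightOneSpectrum (NumberField.RingOfIntegers K)), ((3 : ℕ) : NumberField.RingOfIntegers K) ∈ 𝔭.asIdeal → 𝔭.asIdeal.ramificationIdx (NumberField.RingOfIntegers ℚ) = 1 → 𝔭.asIdeal.inertiaDeg (NumberField.RingOfIntegers ℚ) = 1 → ∀ (𝔭' : IsDedekindDomain.HeightOneSpectrum (NumberField.RingOfIntegers K)), ((3 : ℕ) : NumberField.RingOfIntegers K) ∈ 𝔭'.asIdeal → 𝔭' ≠ 𝔭 → ∀ (ι' : PadicAlgCl 3 ≃+* ℂ), Summit.BirchSwinnertonDyer.BirchSwinnertonDyer.Theorems.SchneiderFree.BranchInducesPrime 3 ι' 𝔭 → ∀ (ΩK : ℂ) (Ωp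 : ℂ_[3]) (L : Literature.NumberTheory.EllipticCurves.UnrSeries 3), ΩK ≠ 0 → Ωp ≠ 0 → Literature.NumberTheory.EllipticCurves.IsBDPLFunction ι' 𝔭 κ γ Dt.f ΩK Ωp L → ∃ θ : ℕ → Literature.NumberTheory.EllipticCurves.IwasawaAlgebra 3, ∀ m : ℕ, (Ideal.Quotient.mk (Ideal.span {((1 + PowerSeries.X) ^ (3 ^ m) - 1 : Literature.NumberTheory.EllipticCurves.IwasawaAlgebra 3)}) (θ m) ∈ Literature.RingTheory.FittingIdeal.Module.fittingIdeal (Literature.NumberTheory.EllipticCurves.IwasawaAlgebra 3 ⧸ Ideal.span {((1 + PowerSeries.X) ^ (3 ^ m) - 1 : Literature.NumberTheory.EllipticCurves.IwasawaAlgebra 3)}) (Summit.BirchSwinnertonDyer.Rank1Residual.X11b.AcSelmer.XAc (W.baseChange K) 3 κ 𝔭' ∅ γ ⧸ (Ideal.span {((1 + PowerSeries.X) ^ (3 ^ m) - 1 : Literature.NumberTheory.EllipticCurves.IwasawaAlgebra 3)} • (⊤ : Submodule (Literature.NumberTheory.EllipticCurves.IwasawaAlgebra 3) (Summit.BirchSwinnertonDyer.Rank1Residual.X11b.AcSelmer.XAc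 (W.baseChange K) 3 κ 𝔭' ∅ γ)))) 0) ∧ L ∈ Ideal.span {PowerSeries.map (Summit.BirchSwinnertonDyer.Rank1Residual.X11b.Halves.toUnr 3) (θ m)} ⊔ Ideal.span {(3 : Literature.NumberTheory.EllipticCurves.UnrSeries 3) ^ m} ⊔ Ideal.span {((1 + PowerSeries.X) ^ (3 ^ m) - 1 : Literature.NumberTheory.EllipticCurves.UnrSeries 3)}) :
    Summit.BirchSwinnertonDyer.BirchSwinnertonDyer.Theses.CumulativeHeegnerLeopoldt.CumulativeHeegnerInclusionAtThree := by
  refine cumulativeHeegnerInclusionAtThree_of_integralCharLayerTower ?_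
  intro W _ _ N _ K _ _ Dt hO6 hRed hcell hr hN hK hHg κ hκ γ _ 𝔭 h𝔭 he hf 𝔭' h𝔭' hne ι' hι ΩK Ωp L hΩK hΩp hBDP m
  haveI : (W.baseChange K).IsElliptic := inferInstanceAs (W.map (algebraMap ℚ K)).IsElliptic
  haveI : Module.Finite (IwasawaAlgebra 3) (XAc (W.baseChange K) 3 κ 𝔭' ∅ γ) := XAc.module_finite_empty κ 𝔭' γ
  obtain ⟨θ, hθ⟩ := hMT W N K Dt hO6 hRed hcell hr hN hK hHg κ hκ γ 𝔭 h𝔭 he hf 𝔭' h𝔭' hne ι' hι ΩK Ωp L hΩK hΩp hBDP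
  -- (MT) with `μ = 0` ⟹ the Fitting layer clause ⟹ the `Ch` layer clause
  have hF := forall_pow_mul_mem_map_fittingIdeal_sup_layer_of_quotientFitting (p := 3) 0 θ (L := L)
    (fun m ↦ (hθ m).1) (fun m ↦ by rw [pow_zero, one_mul]; exact (hθ m).2) m
  rw [pow_zero, one_mul, ← three_eq_natCast] at hF
  exact sup_le_sup_right (sup_le_sup_right
    (map_fittingIdeal_le_map_charIdeal (W.baseChange K) 3 κ 𝔭' γ
      (PowerSeries.map (Summit.BirchSwinnertonDyer.Rank1Residual.X11b.Halves.toUnr 3)))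
    (Ideal.span {(3 : UnrSeries 3) ^ m})) (Ideal.span {((1 + PowerSeries.X) ^ (3 ^ m) - 1 : UnrSeries 3)}) hF

end Summit.BirchSwinnertonDyer.BirchSwinnertonDyer.Theorems.CumulativeHeegnerInclusionAtThreeLayerFittingDoor

end
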